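import Literature.AnabelianGeometry.Anabelioids.FiberFunctorUnique
import Literature.AnabelianGeometry.SemiGraphs.Coverticial

/-!
# Proof of [IUTchI] Remark 2.5.3 (i) (T3): finite coherent semi-graphs of anabelioids are strictly coherent

Mochizuki, *Inter-universal Teichmüller theory I*, Publ. RIMS **57** (2021), Remark 2.5.3 (i) (T3)
[cite: Mochizuki2012, IUTchI Rem. 2.5.3(i)(T3) p.53]: a semi-graph of anabelioids is *strictly
coherent* if it is "coherent [cf. [SemiAnbd], Definition 2.3, (iii)], and, moreover, each of the
profinite groups associated to components `c` … is topologically generated by `N` generators, for some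
positive integer `N` that is independent of `c`.  Thus, if `𝒢` is finite and coherent, then it is
strictly coherent".

This file DISCHARGES the named fact `SemiGraphOfAnabelioids.isStrictlyCoherent_of_finite` of
`Coverticial.lean` (statement by abc-iut-L3-t1): choose a fibre functor at each of the finitely many
components, let `N` bound the sizes of the corresponding dense finitely generated subgroups'
generating sets, and transport a generating set to any other fibre functor along an isomorphism of
topological groups `Aut F₀ ≃ Aut F` (`nonempty_continuousMulEquiv_aut_of_fiberFunctor`), which
preserves density of the generated subgroup.  Proof-only (no definitions).
-/

namespace Literature.AnabelianGeometry.SemiGraphs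

open CategoryTheory CategoryTheory.PreGaloisCategory
open Literature.AnabelianGeometry.Anabelioids

universe v₁ u₁ u

namespace SemiGraphOfAnabelioids

/-- Transport of a dense finite generating set along an isomorphism of topological groups, keeping
the bound on its size. [cite: Mochizuki2012, IUTchI Rem. 2.5.3(i)(T3) p.53] -/
theorem exists_denseGenerators_of_continuousMulEquiv {G H : Type*} [Group G] [TopologicalSpace G]
    [IsTopologicalGroup G] [Group H] [TopologicalSpace H] [IsTopologicalGroup H] [DecidableEq H]
    (e : G ≃ₜ* H) {N : ℕ} (s : Finset G) (hs : s.card ≤ N)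
    (hd : (Subgroup.closure (s : Set G)).topologicalClosure = ⊤) :
    ∃ t : Finset H, t.card ≤ N ∧ (Subgroup.closure (t : Set H)).topologicalClosure = ⊤ := by
  refine ⟨s.image e, Finset.card_image_le.trans hs, ?_⟩
  rw [Finset.coe_image]
  change (Subgroup.closure (e.toMulEquiv.toMonoidHom '' (s : Set G))).topologicalClosure = ⊤
  rw [← MonoidHom.map_closure]
  exact DenseRange.topologicalClosure_map_subgroup (f := e.toMulEquiv.toMonoidHom)
    (map_continuous e) e.surjective.denseRange hd

/-- DISCHARGE of `isStrictlyCoherent_of_finite` ([IUTchI] Remark 2.5.3 (i) (T3), last sentence): a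
finite coherent semi-graph of anabelioids is strictly coherent.
[cite: Mochizuki2012, IUTchI Rem. 2.5.3(i)(T3) p.53] -/
theorem isStrictlyCoherent_of_finite_holds : isStrictlyCoherent_of_finite.{v₁, u₁, u} := by
  intro 𝒢 hfin hcoh
  classical
  refine ⟨hcoh, ?_⟩
  haveI := hfin.finite_vertex
  haveI := hfin.finite_edge
  haveI := Fintype.ofFinite 𝒢.graph.Vertex
  haveI := Fintype.ofFinite 𝒢.graph.Edge
  -- reference fibre functors and dense finite generating sets at each component
  let FV : ∀ v, 𝒢.V v ⥤ FintypeCat.{v₁} := fun v => GaloisCategory.getFiberFunctor (𝒢.V v)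
  let FE : ∀ e, 𝒢.E e ⥤ FintypeCat.{v₁} := fun e => GaloisCategory.getFiberFunctor (𝒢.E e)
  have hV : ∀ v, ∃ s : Finset (Aut (FV v)),
      (Subgroup.closure (s : Set (Aut (FV v)))).topologicalClosure = ⊤ :=
    fun v => (hcoh.fg_V v (FV v)).exists_finset
  have hE : ∀ e, ∃ s : Finset (Aut (FE e)),
      (Subgroup.closure (s : Set (Aut (FE e)))).topologicalClosure = ⊤ :=
    fun e => (hcoh.fg_E e (FE e)).exists_finset
  choose sV hsV using hV
  choose sE hsE using hE
  let N : ℕ := 1 + Finset.univ.sup (fun v => (sV v).card) + Finset.univ.sup (fun e => (sE e).card)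
  have hNV : ∀ v, (sV v).card ≤ N := fun v => by
    have := Finset.le_sup (f := fun v => (sV v).card) (Finset.mem_univ v)
    change (sV v).card ≤ Finset.univ.sup (fun v => (sV v).card) at this
    omega
  have hNE : ∀ e, (sE e).card ≤ N := fun e => by
    have := Finset.le_sup (f := fun e => (sE e).card) (Finset.mem_univ e)
    change (sE e).card ≤ Finset.univ.sup (fun e => (sE e).card) at this
    omega
  refine ⟨N, by omega, fun v F _ => ?_, fun e F _ => ?_⟩
  · obtain ⟨φ⟩ := nonempty_continuousMulEquiv_aut_of_fiberFunctor (FV v) F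
    exact exists_denseGenerators_of_continuousMulEquiv φ (sV v) (hNV v) (hsV v)
  · obtain ⟨φ⟩ := nonempty_continuousMulEquiv_aut_of_fiberFunctor (FE e) F
    exact exists_denseGenerators_of_continuousMulEquiv φ (sE e) (hNE e) (hsE e)

end SemiGraphOfAnabelioids

end Literature.AnabelianGeometry.SemiGraphs
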